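import Summits.QuantumFields.YangMills.Theorems.SwapVirialDeficitBlowUpGnomonicBaseLetterSpeeds
import HarnessLib

/-!
# THE SEAM-COMMUTATOR STIFFNESS FLOOR `[C₀, C₁]` AT THE GNOMONIC BASE POINTS: `Q(w) ≥ ‖[x̂₀, ŵ′(0) − x̂′(0)]‖²/(900·L⁶)` — the END stiffness `x₀²·sin²ψ·|u|²`
# (free-hands support of ⟨stmt-QuantumFields-24197⟩ `SwapVirialDeficit.SwapGluedStiffness`; stub S3∕S4 «finiteness of the bottom measure», END region `ψ → π/2`)

At the END of the hub (`ψ → π/2`, `c² → −1` central) the hub-relation stiffness `sin²2ψ·|u|²` of ✓`leadersW_hubStiff_le` vanishes and the relative-rotation floor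
✓`gnoDeficit_one_ge_relRot` only sees `y₀u − x₀v`; without a further floor the majorant of the Morse–Bott density is log-divergent at `(ψ, y₀) → (π/2, 0)`.  The
missing stiffness is the commutator `[C₀, C₁] = [x̂, Ā·x̂·A·ẑ]` (✓`chartDeficit_ge_of_comm_far`, `μ = 0, ν = 1`): along the fibre ray the commutator path
`f(s) = x̂(s)ŵ(s) − ŵ(s)x̂(s)` vanishes at the flat base point and `f′(0) = [x̂₀, ŵ′(0) − x̂′(0)]` with the explicit speeds of ✓`…BaseLetterSpeeds`
(`x̂′(0) = X′ := (√(1+x₀²))⁻¹·(±(0,0,u))`, `ẑ′(0) = Z′ := (0, z)`, `ŵ′(0) = Ā·X′·A + x̂₀·Z′`), so (✓`iteratedDeriv_two_ge_of_minorant`, ✓`iteratedDeriv_two_norm_sq_of_zero`)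
* ★★★ `fibre_raySecond_ge_seamComm`: `‖x̂₀·q − q·x̂₀‖²/(900·L⁶) ≤ (d²/ds²)F̂(η₀ + s·ξ(w))|₀`, `q = Ā·X′·A + x̂₀·Z′ − X′`, `A = ν(axisPoint a)`, `x̂₀ = ν(±(1,x₀,0,0))`;
* `norm_sq_comm_axial_left`: for axial `x̂₀` (`imJ = imK = 0`), `‖x̂₀q − qx̂₀‖² = 4·x̂₀.imI²·(q.imJ² + q.imK²)` — with `x̂₀.imI² = x₀²/(1+x₀²)` this is the announced
  `x₀²`-stiffness of the transverse letter `u` (the `(j,k)`-part of `Ā·X′·A − X′` has size `2 sin ψ·|u|/√(1+x₀²)`), coupled to `z_⊥` through `x̂₀·Z′`.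

HONEST LABEL: composition of landed inequalities + one-variable calculus; S3∕S4∕S5, ⟨24197⟩ ∕ ⟨24194⟩ ∕ ⟨24497⟩ OPEN; own crux ⟨22884⟩ OPEN (blocked-on ⟨19935⟩); the
Yang–Mills mass gap is NOT proved; no summit is proved by a line.  THEOREMS ONLY (0 `def`, 0 `sorry`), standard axioms.
Width seat ym-line-sfw-p2-w3 g66 (cell ym-idea-1, free hands), `--supports stmt-QuantumFields-24197`.  References: [cite: Luscher1983, §2]; [folklore].
-/

set_option autoImplicit false

noncomputable section

open MeasureTheory Quaternion
open scoped BigOperators Quaternion RealInnerProductSpace ContDiff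
open Literature.MathematicalPhysics.QuantumFieldTheory hiding SU2
open Literature.MathematicalPhysics.QuantumLattice
open Literature.Analysis.Calculus (radialUnit radialUnit_def norm_radialUnit)

namespace Summit.QuantumFields.YangMills.Theorems.SwapVirialDeficit.BlowUpRing

open Summit.QuantumFields.YangMills.Theorems.FemtoTransferGap
open Summit.QuantumFields.YangMills.Theorems.FemtoTransferGap.TT
open Summit.QuantumFields.YangMills.Theorems.FemtoTransferGap.TwoLattice.Flat (fd)
open Summit.QuantumFields.YangMills.Theorems.VirialFluxGap.RingDeficit
open Summit.QuantumFields.YangMills.Theorems.SwapVirialDeficit.SwapRing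
open Summit.QuantumFields.YangMills.Theorems.SwapTwistDeficit.ToronLog (axisPoint norm_comm_sq)
open Summit.QuantumFields.YangMills.Theorems.SwapVirialDeficit.ZeroModeSigma (norm_axisUnit su2Quat_quatToSU2_eq_radialUnit axisUnit_axial)
open Summit.QuantumFields.YangMills.Theorems.SwapVirialDeficit.Gnomonic (contDiff_gnoDeficit contDiff_radialUnit_gnoLetter)
open Summit.QuantumFields.YangMills.Theorems.QuantitativeLaplace (iteratedDeriv_two_ge_of_minorant)
open Summit.QuantumFields.YangMills.Theorems.ToronValleyVolume.Lojasiewicz (fd_sq_eq_two_mul)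

variable {L : ℕ} [NeZero L]

/-! ## §1 The commutator of an axial quaternion in coordinates -/

omit [NeZero L] in
/-- For an axial `x` (`imJ x = imK x = 0`): `‖xq − qx‖² = 4·x.imI²·(q.imJ² + q.imK²)`. [folklore] -/
theorem norm_sq_comm_axial_left {x : ℍ} (hx : x.imJ = 0 ∧ x.imK = 0) (q : ℍ) :
    ‖x * q - q * x‖ ^ 2 = 4 * x.imI ^ 2 * (q.imJ ^ 2 + q.imK ^ 2) := by
  rw [norm_comm_sq, hx.1, hx.2]
  ring

/-! ## §2 The seam-commutator ray minorant and its second derivative -/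

/-- ★★★ **THE SEAM-COMMUTATOR FLOOR** (principal sector; hub `a ≠ 0`, signs `ε_z = +`, followers `+`): for every fibre direction `w`,
`‖x̂₀·q − q·x̂₀‖²/(900·L⁶) ≤ (d²/ds²) F̂(η₀ + s·ξ(w))|₀` with `x̂₀ = ν(gnoLetter ε_x (x₀,0,0))`, `A = ν(axisPoint a)`,
`X′ = (√(1+x₀²))⁻¹·(gnoSign ε_x·(0,0,u₀,u₁))`, `Z′ = (0, z)`, `q = Ā·X′·A + x̂₀·Z′ − X′`. [cite: Luscher1983, §2] -/
theorem fibre_raySecond_ge_seamComm {a : ℍ} (ha : a ≠ 0) (ε : GnoSign L) (hz : ε.2.1 = true) (hε : ε.2.2 = fun _ => true) (x₀ y₀ : ℝ)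
    (w : ((Fin 2 → ℝ) × (Fin 2 → ℝ)) × (Fin 3 → ℝ) × (Fol L → Fin 3 → ℝ)) :
    ‖radialUnit (gnoLetter ε.1.1 ![x₀, 0, 0]) *
          (star (radialUnit (axisPoint a)) * ((Real.sqrt (1 + x₀ ^ 2))⁻¹ • (gnoSign ε.1.1 • (gnomonicQuat ![0, w.1.1 0, w.1.1 1]).im)) * radialUnit (axisPoint a) +
            radialUnit (gnoLetter ε.1.1 ![x₀, 0, 0]) * (gnomonicQuat w.2.1).im -
            (Real.sqrt (1 + x₀ ^ 2))⁻¹ • (gnoSign ε.1.1 • (gnomonicQuat ![0, w.1.1 0, w.1.1 1]).im)) -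
        (star (radialUnit (axisPoint a)) * ((Real.sqrt (1 + x₀ ^ 2))⁻¹ • (gnoSign ε.1.1 • (gnomonicQuat ![0, w.1.1 0, w.1.1 1]).im)) * radialUnit (axisPoint a) +
            radialUnit (gnoLetter ε.1.1 ![x₀, 0, 0]) * (gnomonicQuat w.2.1).im -
            (Real.sqrt (1 + x₀ ^ 2))⁻¹ • (gnoSign ε.1.1 • (gnomonicQuat ![0, w.1.1 0, w.1.1 1]).im)) *
          radialUnit (gnoLetter ε.1.1 ![x₀, 0, 0])‖ ^ 2 / (900 * (L : ℝ) ^ 6) ≤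
      iteratedDeriv 2 (fun s : ℝ => gnoDeficit (fun _ => false) (fun _ => 1) a ε
        (((((![x₀, 0, 0] : Fin 3 → ℝ), (![y₀, 0, 0] : Fin 3 → ℝ)), ((0 : Fin 3 → ℝ), (0 : Fol L → Fin 3 → ℝ))) : GnoCoord L) +
          s • ((((![0, w.1.1 0, w.1.1 1] : Fin 3 → ℝ), (![0, w.1.2 0, w.1.2 1] : Fin 3 → ℝ)), (w.2.1, w.2.2)) : GnoCoord L))) 0 := by
  have hL : (0 : ℝ) < L := by exact_mod_cast NeZero.pos L
  -- names
  set A : ℍ := radialUnit (axisPoint a) with hA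
  set X' : ℍ := (Real.sqrt (1 + x₀ ^ 2))⁻¹ • (gnoSign ε.1.1 • (gnomonicQuat ![0, w.1.1 0, w.1.1 1]).im) with hX'
  set Z' : ℍ := (gnomonicQuat w.2.1).im with hZ'
  set η : ℝ → GnoCoord L := fun s =>
    (((((![x₀, 0, 0] : Fin 3 → ℝ), (![y₀, 0, 0] : Fin 3 → ℝ)), ((0 : Fin 3 → ℝ), (0 : Fol L → Fin 3 → ℝ))) : GnoCoord L) +
      s • ((((![0, w.1.1 0, w.1.1 1] : Fin 3 → ℝ), (![0, w.1.2 0, w.1.2 1] : Fin 3 → ℝ)), (w.2.1, w.2.2)) : GnoCoord L)) with hη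
  set xh : ℝ → ℍ := fun s => su2Quat (quatToSU2 (gnoLetter ε.1.1 ((![x₀, 0, 0] : Fin 3 → ℝ) + s • ![0, w.1.1 0, w.1.1 1]))) with hxh
  set zh : ℝ → ℍ := fun s => su2Quat (quatToSU2 (gnoLetter true (s • w.2.1))) with hzh
  set wh : ℝ → ℍ := fun s => star A * xh s * A * zh s with hwh
  set f : ℝ → ℍ := fun s => xh s * wh s - wh s * xh s with hf
  set φ : ℝ → ℝ := fun s => gnoDeficit (fun _ => false) (fun _ => 1) a ε (η s) with hφ
  have hA1 : ‖A‖ = 1 := norm_axisUnit ha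
  -- the letters of the ray point
  have hlet : ∀ s, (η s).1.1 = (![x₀, 0, 0] : Fin 3 → ℝ) + s • ![0, w.1.1 0, w.1.1 1] ∧ (η s).2.1 = s • w.2.1 := fun s => by
    obtain ⟨e1, -, e3, -⟩ := fibrePoint_ray_letters (L := L) x₀ y₀ s w
    exact ⟨e1, e3⟩
  have hxh_rad : ∀ s, xh s = radialUnit (gnoLetter ε.1.1 ((![x₀, 0, 0] : Fin 3 → ℝ) + s • ![0, w.1.1 0, w.1.1 1])) := fun s =>
    su2Quat_quatToSU2_eq_radialUnit (gnoLetter_ne_zero _ _)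
  have hzh_rad : ∀ s, zh s = radialUnit (gnoLetter true (s • w.2.1)) := fun s => su2Quat_quatToSU2_eq_radialUnit (gnoLetter_ne_zero _ _)
  -- leaders `C₀`, `C₁` along the ray read through `su2Quat`
  have hC0 : ∀ s, su2Quat ((blowUpPoint (L := L) 1 (gnomonicPoint a ε (η s))).1 0) = xh s := fun s => by
    rw [su2Quat_gnoLeader_zero, (hlet s).1, hxh_rad]
  have hC1 : ∀ s, su2Quat ((blowUpPoint (L := L) 1 (gnomonicPoint a ε (η s))).1 1) = wh s := fun s => by
    rw [su2Quat_gnoLeader_one ha, (hlet s).1, (hlet s).2, hz]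
    show _ = star A * xh s * A * zh s
    rw [hxh_rad, hzh_rad]
  -- the minorant `γ(s) = ‖f s‖²/(1800 L⁶) ≤ φ s`
  have hγle : ∀ s, ‖f s‖ ^ 2 / (1800 * (L : ℝ) ^ 6) ≤ φ s := by
    intro s
    set q := blowUpPoint (L := L) 1 (gnomonicPoint a ε (η s)) with hq
    have h := chartDeficit_ge_of_comm_far (L := L) q 0 1 (frobNorm_nonneg _) le_rfl
    have e0 : (Fin.castSucc (0 : Fin 3) : Fin 4) = 0 := rfl
    have e1 : (Fin.castSucc (1 : Fin 3) : Fin 4) = 1 := rfl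
    rw [e0, e1] at h
    have hfd : frobNorm (((q.1 0 * q.1 1 : SU2) : Matrix (Fin 2) (Fin 2) ℂ) - ((q.1 1 * q.1 0 : SU2) : Matrix (Fin 2) (Fin 2) ℂ)) = fd (q.1 0 * q.1 1) (q.1 1 * q.1 0) := by
      simp only [fd]
    have hsq : frobNorm (((q.1 0 * q.1 1 : SU2) : Matrix (Fin 2) (Fin 2) ℂ) - ((q.1 1 * q.1 0 : SU2) : Matrix (Fin 2) (Fin 2) ℂ)) ^ 2 = 2 * ‖f s‖ ^ 2 := by
      rw [hfd, fd_sq_eq_two_mul, Balaban1983to89.T4HaarSU2Translate.su2Quat_mul, Balaban1983to89.T4HaarSU2Translate.su2Quat_mul, hq, hC0, hC1]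
    rw [hsq] at h
    show ‖f s‖ ^ 2 / (1800 * (L : ℝ) ^ 6) ≤ gnoDeficit (fun _ => false) (fun _ => 1) a ε (η s)
    unfold gnoDeficit
    calc ‖f s‖ ^ 2 / (1800 * (L : ℝ) ^ 6) = 2 * ‖f s‖ ^ 2 / (3600 * (L : ℝ) ^ 6) := by field_simp; ring
      _ ≤ _ := h
  -- smoothness
  have hxhd : ContDiff ℝ ∞ xh :=
    (contDiff_radialUnit_gnoLetter (n := ⊤) ε.1.1).comp (contDiff_const.add (contDiff_id.smul contDiff_const))
  have hzhd : ContDiff ℝ ∞ zh := (contDiff_radialUnit_gnoLetter (n := ⊤) true).comp (contDiff_id.smul contDiff_const)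
  have hwhd : ContDiff ℝ ∞ wh := ((contDiff_const.mul hxhd).mul contDiff_const).mul hzhd
  have hfd : ContDiff ℝ ∞ f := (hxhd.mul hwhd).sub (hwhd.mul hxhd)
  have hγd : ContDiff ℝ ∞ (fun s => ‖f s‖ ^ 2 / (1800 * (L : ℝ) ^ 6)) := (hfd.norm_sq ℝ).div_const _
  have hφd : ContDiff ℝ ∞ φ := contDiff_gnoDeficit_ray (L := L) (fun _ => false) (fun _ => 1) ha ε _ _ (n := ⊤)
  -- values at `0`
  have hx0 : xh 0 = radialUnit (gnoLetter ε.1.1 ![x₀, 0, 0]) := by rw [hxh_rad]; simp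
  have hz0 : zh 0 = 1 := by rw [hzh_rad, zero_smul, gnoLetter_true_zero, radialUnit_one_quat]
  have hax : (xh 0).imJ = 0 ∧ (xh 0).imK = 0 := by rw [hx0]; exact axial_radialUnit (axial_gnoLetter _ _)
  have hAx : star A * xh 0 * A = xh 0 := star_mul_mul_eq_of_axial hA1 (axisUnit_axial a) hax
  have hw0 : wh 0 = xh 0 := by simp only [hwh, hz0, mul_one, hAx]
  have hf0 : f 0 = 0 := by simp only [hf, hw0, sub_self]
  have hφ0 : φ 0 = 0 := by
    simp only [hφ, hη, zero_smul, add_zero]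
    exact gnoDeficit_base_eq_zero ha ε hz hε x₀ y₀
  -- speeds at `0`
  have hxs : HasDerivAt xh X' 0 := by
    have h := hasDerivAt_xhat_ray ε.1.1 x₀ (w.1.1 0) (w.1.1 1)
    have e : xh = fun s => radialUnit (gnoLetter ε.1.1 ((![x₀, 0, 0] : Fin 3 → ℝ) + s • ![0, w.1.1 0, w.1.1 1])) := funext hxh_rad
    rw [e]; exact h
  have hzs : HasDerivAt zh Z' 0 := by
    have h := hasDerivAt_zhat_ray (w.2.1)
    have e : zh = fun s => radialUnit (gnoLetter true (s • w.2.1)) := funext hzh_rad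
    rw [e]; exact h
  have hws : HasDerivAt wh (star A * X' * A + xh 0 * Z') 0 := hasDerivAt_slaved_ray hxs hzs hz0 hAx
  have hfs : HasDerivAt f (X' * wh 0 + xh 0 * (star A * X' * A + xh 0 * Z') - ((star A * X' * A + xh 0 * Z') * xh 0 + wh 0 * X')) 0 :=
    (hxs.mul hws).sub (hws.mul hxs)
  have hderiv : deriv f 0 = xh 0 * (star A * X' * A + xh 0 * Z' - X') - (star A * X' * A + xh 0 * Z' - X') * xh 0 := by
    rw [hfs.deriv, hw0]; noncomm_ring
  -- second derivative of the minorant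
  have hγ2 : iteratedDeriv 2 (fun s => ‖f s‖ ^ 2 / (1800 * (L : ℝ) ^ 6)) 0 = 2 * ‖deriv f 0‖ ^ 2 / (1800 * (L : ℝ) ^ 6) := by
    have e : (fun s => ‖f s‖ ^ 2 / (1800 * (L : ℝ) ^ 6)) = fun s => (1800 * (L : ℝ) ^ 6)⁻¹ * ‖f s‖ ^ 2 := by
      funext s; rw [div_eq_inv_mul]
    rw [e, iteratedDeriv_const_mul _ ((hfd.norm_sq ℝ).contDiffAt.of_le (by norm_cast)),
      iteratedDeriv_two_norm_sq_of_zero (hfd.of_le (by norm_cast)) hf0]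
    rw [div_eq_inv_mul]
  -- the minorant comparison
  have key := iteratedDeriv_two_ge_of_minorant hφd hγd hγle (by
    show ‖f 0‖ ^ 2 / (1800 * (L : ℝ) ^ 6) = φ 0
    rw [hf0, hφ0, norm_zero]; simp)
  rw [hγ2, hderiv, hx0] at key
  calc _ = 2 * ‖radialUnit (gnoLetter ε.1.1 ![x₀, 0, 0]) * (star A * X' * A + radialUnit (gnoLetter ε.1.1 ![x₀, 0, 0]) * Z' - X') -
        (star A * X' * A + radialUnit (gnoLetter ε.1.1 ![x₀, 0, 0]) * Z' - X') * radialUnit (gnoLetter ε.1.1 ![x₀, 0, 0])‖ ^ 2 / (1800 * (L : ℝ) ^ 6) := by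
        field_simp; ring
    _ ≤ _ := key

end Summit.QuantumFields.YangMills.Theorems.SwapVirialDeficit.BlowUpRing

end
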